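import Summits.CriticalPhenomena.SAWScalingLimit.Theorems.SAWDevelopingMapHexConjectureKPCountB
import Summits.CriticalPhenomena.SAWScalingLimit.Theorems.SAWDevelopingMapHexConjectureKPRenewalBound
import Summits.CriticalPhenomena.SAWScalingLimit.Theorems.SAWDevelopingMapHexConjectureKPClip
import Summits.CriticalPhenomena.SAWScalingLimit.Theorems.SAWDevelopingMapHexConjectureTriDlPos
import HarnessLib

/-!
# Crux `HexConjecture` (stmt-CriticalPhenomena-0808), line `root-locality-replaces-loewner`:
Krachun–Panagiotis's dichotomy (registered stub `stub_kp_dichotomy`)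

Landing target:
`Summits/CriticalPhenomena/SAWScalingLimit/Theorems/SAWDevelopingMapHexConjectureKPDichotomy.lean`
(`--supports stmt-CriticalPhenomena-0808`; lead prover-line-stmt-CriticalPhenomena-0808-c9-0).

[KP, §3.2, eqs. (4)–(5) and Lemmas 3.2–3.3] in the CONFINED form of the tree.  Fix `T ≥ 1` and caps
`M₁ ≥ M_k` (`k ∈ [T, 2T)`), `M₂ ≥ M_i` (`i ∈ [4T, 5T)`), `M_k = renCap k`.  For every `k ∈ [T, 2T)` the
right walks of the triangle `T_k` with at most `M_k` renewal times weigh at least `(7/8)·triDr k`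
(Markov over the renewal bound of Lemma 3.1, `renBound_markov`; `dich_kept_ge`), hence at least
`(7/8)·triDl(2T)`; summed over `k` and split according to whether the exit height is GOOD (some
`i ∈ [4T, 5T)` has `D⁻_{2i+1,x} ≥ D_{2i+1}/4`) or BAD, either the good part `G ≥ (1/4)·T·triDl(2T)` or the
bad part `Bd ≥ (5/8)·T·triDl(2T)` (`dich_kept_sum_ge`, `dich_split`).
* GOOD (Lemma 3.2, construction (a)): for a good height the cut exits of the clipped triangle at the
  chosen scale weigh `clipE ≥ (cos(π/8)/cos(π/4))·D⁻ ≥ (cos(π/8)/(2cos(π/4)))·triDl(5T)`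
  (`triDminus_le_clipE`, `dich_clipE_ge`), so the counted mass of construction (a) is at least
  `G·(cos(π/8)/(2cos(π/4)))·triDl(5T)`; with `stub_kp_countA` this is the first alternative.
* BAD (Lemma 3.3, construction (b)): for a bad height and every `i ∈ [4T, 5T)` the right exits of the
  clipped triangle weigh `clipDr = triDr − D⁻ > triDl i/2` (`triDr_eq_clipDr_add_triDminus`), those with
  few renewal times at least `(3/8)·triDl i ≥ (3/8)·triDl(5T)` (`dich_clip_kept_ge`), and the third
  triangle hanging from such an exit has size `≤ 9T`, mass `≥ triDl(9T)` (`dich_third_ge`); so the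
  counted mass of construction (b) is at least `Bd·T·(3/8)·triDl(5T)·triDl(9T)`; with `stub_kp_countB`
  this is the second alternative.
The constants of the registered statement, `cos(π/8)/(16cos(π/4))` and `15/64 = (5/8)(3/8)`, are
(weaker than or equal to) what this yields.
-/

noncomputable section

open scoped Classical
open Finset
open Literature.Probability.RandomPlanarGeometry.SAW Literature.Probability.RandomPlanarGeometry.SAW.HV

namespace Summit.CriticalPhenomena.SAWScalingLimit.Theorems.HexConjecture.RootLocality

/-! ### Markov at the cap: the walks with few renewal times carry `7/8` of the mass -/

/-- `0 ≤ x_c`. [cite: DuminilCopinSmirnov2012, §1] -/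
theorem dich_xc_nonneg : 0 ≤ hexCriticalFugacity := hexCriticalFugacity_pos_lt_one.1.le

/-- The renewal bound is positive (its `i = 0` term is `2·triDl 0 · 2cos(π/8)·triDl ⌊(k-1)/2⌋ > 0`).
[cite: KrachunPanagiotis2026, Lemma 3.1] -/
theorem dich_renBound_pos (k : ℕ) : 0 < renBound k := by
  rw [renBound]
  have h0 : (0 : ℕ) ∈ range (k + 1) := by simp
  refine lt_of_lt_of_le ?_ (single_le_sum
    (f := fun i => 2 * triDl i * (2 * Real.cos (Real.pi / 8) * triDl ((k - i - 1) / 2)))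
    (fun i _ => ?_) h0)
  · exact mul_pos (mul_pos two_pos (stub_triDl_pos 0))
      (mul_pos (mul_pos two_pos cos_pi_div_eight_pos) (stub_triDl_pos _))
  · exact mul_nonneg (mul_nonneg zero_le_two (triDl_nonneg i))
      (mul_nonneg (mul_nonneg zero_le_two cos_pi_div_eight_pos.le) (triDl_nonneg _))

/-- `triDr k > 0`. [cite: GlazmanManolescu2019, §4.1] -/
theorem dich_triDr_pos (k : ℕ) : 0 < triDr k := by
  rw [← triDl_eq_triDr]; exact stub_triDl_pos k

/-- KP's cap `M_k` is positive. [cite: KrachunPanagiotis2026, §3.2 (M_k)] -/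
theorem dich_renCap_pos (k : ℕ) : 0 < renCap k := by
  rw [renCap]; exact div_pos (mul_pos (by norm_num) (dich_renBound_pos k)) (dich_triDr_pos k)

/-- **Markov at the cap**: the right walks of `T_k` with more than `M_k` renewal times weigh at most
`triDr k / 8` ("`P[N > M_k] ≤ 1/8`"). [cite: KrachunPanagiotis2026, §3.2 (M_k, Markov)] -/
theorem dich_tail_le (k : ℕ) :
    ∑ P ∈ (rightWalks k).filter (fun P => renCap k < (renewals k P : ℝ)),
      hexCriticalFugacity ^ mwLen P ≤ triDr k / 8 := by
  refine (renBound_markov k (dich_renCap_pos k)).trans (le_of_eq ?_)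
  rw [renCap]
  have h1 := (dich_renBound_pos k).ne'
  have h2 := (dich_triDr_pos k).ne'
  field_simp

/-- **The kept mass**: the right walks of `T_k` with at most `M_k` renewal times weigh at least
`(7/8)·triDr k`. [cite: KrachunPanagiotis2026, §3.2 ("with probability at least 7/8")] -/
theorem dich_kept_ge (k : ℕ) :
    7 / 8 * triDr k ≤ ∑ P ∈ (rightWalks k).filter (fun P => (renewals k P : ℝ) ≤ renCap k),
      hexCriticalFugacity ^ mwLen P := by
  have hsplit := sum_filter_add_sum_filter_not (rightWalks k)
    (fun P => (renewals k P : ℝ) ≤ renCap k) (fun P => hexCriticalFugacity ^ mwLen P)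
  rw [← triDr_eq_sum_rightWalks] at hsplit
  have htail : ∑ P ∈ (rightWalks k).filter (fun P => ¬ ((renewals k P : ℝ) ≤ renCap k)),
      hexCriticalFugacity ^ mwLen P ≤ triDr k / 8 := by
    refine le_trans ?_ (dich_tail_le k)
    refine sum_le_sum_of_subset_of_nonneg ?_ fun _ _ _ => pow_nonneg dich_xc_nonneg _
    intro P hP
    rw [mem_filter] at hP ⊢
    exact ⟨hP.1, not_le.1 hP.2⟩
  linarith

/-- The kept mass summed over the scales `k ∈ [T, 2T)` is at least `(7/8)·T·triDl(2T)`
(`triDr k = triDl k ≥ triDl (2T)`). [cite: KrachunPanagiotis2026, §3.2] -/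
theorem dich_kept_sum_ge (T : ℕ) :
    7 / 8 * (T : ℝ) * triDl (2 * T) ≤ ∑ k ∈ Ico T (2 * T),
      ∑ P ∈ (rightWalks k).filter (fun P => (renewals k P : ℝ) ≤ renCap k),
        hexCriticalFugacity ^ mwLen P := by
  calc 7 / 8 * (T : ℝ) * triDl (2 * T) = ∑ _k ∈ Ico T (2 * T), 7 / 8 * triDl (2 * T) := by
        rw [sum_const, nsmul_eq_mul, Nat.card_Ico, show 2 * T - T = T by omega]; ring
    _ ≤ _ := sum_le_sum fun k hk => by
        rw [mem_Ico] at hk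
        calc 7 / 8 * triDl (2 * T) ≤ 7 / 8 * triDr k := by
              rw [← triDl_eq_triDr]
              exact mul_le_mul_of_nonneg_left (triDl_antitone (by omega)) (by norm_num)
          _ ≤ _ := dich_kept_ge k

/-- The kept mass splits into the walks with a GOOD and with a BAD exit height.
[cite: KrachunPanagiotis2026, §3.2 (eqs. (4)–(5))] -/
theorem dich_split (T k : ℕ) :
    ∑ P ∈ (rightWalks k).filter (fun P => (renewals k P : ℝ) ≤ renCap k),
        hexCriticalFugacity ^ mwLen P =
      ∑ P ∈ (rightWalks k).filter (fun P => (renewals k P : ℝ) ≤ renCap k ∧ GoodHt T (htOf P)),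
          hexCriticalFugacity ^ mwLen P +
        ∑ P ∈ (rightWalks k).filter (fun P => (renewals k P : ℝ) ≤ renCap k ∧ ¬ GoodHt T (htOf P)),
          hexCriticalFugacity ^ mwLen P := by
  have h := sum_filter_add_sum_filter_not ((rightWalks k).filter (fun P => (renewals k P : ℝ) ≤ renCap k))
    (fun P => GoodHt T (htOf P)) (fun P => hexCriticalFugacity ^ mwLen P)
  rw [filter_filter, filter_filter] at h
  exact h.symm

/-! ### The good case: construction (a) -/

/-- **A good height feeds construction (a)**: at the chosen scale `i_x ∈ [4T, 5T)` the cut exits of the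
clipped triangle weigh `F^B ≥ (cos(π/8)/cos(π/4))·D⁻ ≥ (cos(π/8)/(2cos(π/4)))·triDl(5T)`.
[cite: KrachunPanagiotis2026, proof of Lemma 3.2 (eq. (8) and "D⁻ ≥ D/4")] -/
theorem dich_clipE_ge {T h : ℕ} (H : GoodHt T h) :
    Real.cos (Real.pi / 8) / (2 * Real.cos (Real.pi / 4)) * triDl (5 * T) ≤ clipE (goodIdx T h) h := by
  obtain ⟨-, h2, h3⟩ := goodIdx_spec H
  have hc4 := cos_pi_div_four_pos'
  have hc8 := cos_pi_div_eight_pos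
  have hE := triDminus_le_clipE (goodIdx T h) h
  have hmono : triDl (5 * T) ≤ triDl (goodIdx T h) := triDl_antitone h2.le
  have h4 : Real.cos (Real.pi / 8) * triDl (5 * T) ≤
      2 * Real.cos (Real.pi / 4) * clipE (goodIdx T h) h := by
    have h5 := mul_le_mul_of_nonneg_left hmono hc8.le
    have h6 := mul_le_mul_of_nonneg_left h3 hc8.le
    linarith
  have h7 : Real.cos (Real.pi / 8) / (2 * Real.cos (Real.pi / 4)) * triDl (5 * T) =
      Real.cos (Real.pi / 8) * triDl (5 * T) / (2 * Real.cos (Real.pi / 4)) := by ring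
  rw [h7, div_le_iff₀ (mul_pos two_pos hc4)]
  linarith

/-- The counted mass of construction (a) is at least `G·(cos(π/8)/(2cos(π/4)))·triDl(5T)`.
[cite: KrachunPanagiotis2026, proof of Lemma 3.2 (eq. (9), left side)] -/
theorem dich_caseA_ge (T : ℕ) :
    (∑ k ∈ Ico T (2 * T), ∑ P ∈ (rightWalks k).filter
        (fun P => (renewals k P : ℝ) ≤ renCap k ∧ GoodHt T (htOf P)), hexCriticalFugacity ^ mwLen P) *
      (Real.cos (Real.pi / 8) / (2 * Real.cos (Real.pi / 4)) * triDl (5 * T)) ≤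
    ∑ k ∈ Ico T (2 * T), ∑ P ∈ (rightWalks k).filter
        (fun P => (renewals k P : ℝ) ≤ renCap k ∧ GoodHt T (htOf P)),
      hexCriticalFugacity ^ mwLen P * clipE (goodIdx T (htOf P)) (htOf P) := by
  rw [sum_mul]
  refine sum_le_sum fun k _ => ?_
  rw [sum_mul]
  refine sum_le_sum fun P hP => ?_
  rw [mem_filter] at hP
  exact mul_le_mul_of_nonneg_left (dich_clipE_ge hP.2.2) (pow_nonneg dich_xc_nonneg _)

/-! ### The bad case: construction (b) -/

/-- **The third triangle is large**: for `γ₁ ∈ D(Tria_{2k+1})`, `k < 2T` (exit height `h ≤ 2k < 4T`) and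
a right exit `γ₂` of the clipped triangle at scale `i < 5T` (exit abscissa `p₀ ≥ -i`), the triangle
hanging from the exit of `γ₂` has size `h - p₀ ≤ 9T`, so its right mass is at least `triDl(9T)`
("γ³ ∈ D(Tria_{2r+1,y}) for some r ≤ 9T"). [cite: KrachunPanagiotis2026, proof of Lemma 3.3] -/
theorem dich_third_ge {T k i : ℕ} {P₁ P₂ : List HV} (hk : k < 2 * T) (hi : i < 5 * T)
    (hP₁ : P₁ ∈ rightWalks k) (hP₂ : P₂ ∈ midWalks (clipV i (htOf P₁)))
    (hR : IsRightDart i (finalDart P₂)) :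
    triDl (9 * T) ≤ triDr ((((htOf P₁ : ℕ) : ℤ) - (finalDart P₂).1.1).toNat) := by
  rw [← triDl_eq_triDr]
  refine triDl_antitone ?_
  have h1 := (rightWalks_crossings hP₁).2.2.2
  have h2 := (rightWalks_crossings (rightWalks_of_clip hP₂ hR)).2.2.2
  have h3 := hR.1
  have hh : ((htOf P₁ : ℕ) : ℤ) ≤ 2 * k := by
    rw [htOf, Int.toNat_of_nonneg h1.1]; exact h1.2
  omega

/-- **A bad height feeds construction (b)**: if NO `i ∈ [4T, 5T)` has `D⁻_{2i+1,x} ≥ D_{2i+1}/4`, then for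
every such `i` the right exits of the clipped triangle weigh `clipDr = triDr − D⁻ > triDl i/2`, and those
with at most `M_i` renewal times at least `triDl i/2 − triDl i/8 ≥ (3/8)·triDl(5T)`.
[cite: KrachunPanagiotis2026, §3.2 (eq. (5)) and proof of Lemma 3.3] -/
theorem dich_clip_kept_ge {T i h : ℕ} (hbad : ¬ GoodHt T h) (hi : 4 * T ≤ i) (hi' : i < 5 * T) :
    3 / 8 * triDl (5 * T) ≤ ∑ P ∈ (midWalks (clipV i h)).filter
        (fun P => IsRightDart i (finalDart P) ∧ (renewals i P : ℝ) ≤ renCap i),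
      hexCriticalFugacity ^ mwLen P := by
  have hlt : triDminus i h < triDl i / 2 := by
    by_contra hge
    exact hbad ⟨i, hi, hi', not_lt.1 hge⟩
  have hdec := triDr_eq_clipDr_add_triDminus i h
  have heq := triDl_eq_triDr i
  have hsplit := sum_filter_add_sum_filter_not
    ((midWalks (clipV i h)).filter (fun P => IsRightDart i (finalDart P)))
    (fun P => (renewals i P : ℝ) ≤ renCap i) (fun P => hexCriticalFugacity ^ mwLen P)
  rw [filter_filter, filter_filter] at hsplit
  have hclipDr : clipDr i h = ∑ P ∈ (midWalks (clipV i h)).filter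
      (fun P => IsRightDart i (finalDart P)), hexCriticalFugacity ^ mwLen P := rfl
  have hdrop : ∑ P ∈ (midWalks (clipV i h)).filter
      (fun P => IsRightDart i (finalDart P) ∧ ¬ ((renewals i P : ℝ) ≤ renCap i)),
        hexCriticalFugacity ^ mwLen P ≤ triDr i / 8 := by
    refine le_trans ?_ (dich_tail_le i)
    refine sum_le_sum_of_subset_of_nonneg ?_ fun _ _ _ => pow_nonneg dich_xc_nonneg _
    intro P hP
    rw [mem_filter] at hP ⊢
    exact ⟨rightWalks_of_clip hP.1 hP.2.1, not_le.1 hP.2.2⟩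
  have hmono : triDl (5 * T) ≤ triDl i := triDl_antitone hi'.le
  linarith

/-- The inner sum of construction (b) for a bad `γ₁`: at least `T·(3/8)·triDl(5T)·triDl(9T)`.
[cite: KrachunPanagiotis2026, proof of Lemma 3.3 (eq. (10), left side)] -/
theorem dich_caseB_inner_ge {T k : ℕ} {P₁ : List HV} (hk : k < 2 * T) (hP₁ : P₁ ∈ rightWalks k)
    (hbad : ¬ GoodHt T (htOf P₁)) :
    (T : ℝ) * (3 / 8 * triDl (5 * T) * triDl (9 * T)) ≤
      ∑ i ∈ Ico (4 * T) (5 * T), ∑ P₂ ∈ (midWalks (clipV i (htOf P₁))).filter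
          (fun P => IsRightDart i (finalDart P) ∧ (renewals i P : ℝ) ≤ renCap i),
        hexCriticalFugacity ^ mwLen P₂ * triDr ((((htOf P₁ : ℕ) : ℤ) - (finalDart P₂).1.1).toNat) := by
  calc (T : ℝ) * (3 / 8 * triDl (5 * T) * triDl (9 * T))
      = ∑ _i ∈ Ico (4 * T) (5 * T), 3 / 8 * triDl (5 * T) * triDl (9 * T) := by
        rw [sum_const, nsmul_eq_mul, Nat.card_Ico, show 5 * T - 4 * T = T by omega]
    _ ≤ _ := sum_le_sum fun i hi => by
        rw [mem_Ico] at hi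
        calc 3 / 8 * triDl (5 * T) * triDl (9 * T)
            ≤ (∑ P₂ ∈ (midWalks (clipV i (htOf P₁))).filter
                  (fun P => IsRightDart i (finalDart P) ∧ (renewals i P : ℝ) ≤ renCap i),
                hexCriticalFugacity ^ mwLen P₂) * triDl (9 * T) :=
              mul_le_mul_of_nonneg_right (dich_clip_kept_ge hbad hi.1 hi.2) (triDl_nonneg _)
          _ = ∑ P₂ ∈ (midWalks (clipV i (htOf P₁))).filter
                  (fun P => IsRightDart i (finalDart P) ∧ (renewals i P : ℝ) ≤ renCap i),
                hexCriticalFugacity ^ mwLen P₂ * triDl (9 * T) := sum_mul _ _ _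
          _ ≤ _ := sum_le_sum fun P₂ hP₂ => by
              rw [mem_filter] at hP₂
              exact mul_le_mul_of_nonneg_left (dich_third_ge hk hi.2 hP₁ hP₂.1 hP₂.2.1)
                (pow_nonneg dich_xc_nonneg _)

/-- The counted mass of construction (b) is at least `Bd·T·(3/8)·triDl(5T)·triDl(9T)`.
[cite: KrachunPanagiotis2026, proof of Lemma 3.3 (eq. (10))] -/
theorem dich_caseB_ge (T : ℕ) :
    (∑ k ∈ Ico T (2 * T), ∑ P ∈ (rightWalks k).filter
        (fun P => (renewals k P : ℝ) ≤ renCap k ∧ ¬ GoodHt T (htOf P)), hexCriticalFugacity ^ mwLen P) *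
      ((T : ℝ) * (3 / 8 * triDl (5 * T) * triDl (9 * T))) ≤
    ∑ k ∈ Ico T (2 * T), ∑ P₁ ∈ (rightWalks k).filter
        (fun P => (renewals k P : ℝ) ≤ renCap k ∧ ¬ GoodHt T (htOf P)),
      hexCriticalFugacity ^ mwLen P₁ *
        ∑ i ∈ Ico (4 * T) (5 * T), ∑ P₂ ∈ (midWalks (clipV i (htOf P₁))).filter
            (fun P => IsRightDart i (finalDart P) ∧ (renewals i P : ℝ) ≤ renCap i),
          hexCriticalFugacity ^ mwLen P₂ * triDr ((((htOf P₁ : ℕ) : ℤ) - (finalDart P₂).1.1).toNat) := by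
  rw [sum_mul]
  refine sum_le_sum fun k hk => ?_
  rw [mem_Ico] at hk
  rw [sum_mul]
  refine sum_le_sum fun P hP => ?_
  rw [mem_filter] at hP
  exact mul_le_mul_of_nonneg_left (dich_caseB_inner_ge hk.2 hP.1 hP.2.2) (pow_nonneg dich_xc_nonneg _)

/-! ### The dichotomy -/

/-- **Registered sub-goal `stub_kp_dichotomy`** (crux item stmt-CriticalPhenomena-0808, line
`root-locality-replaces-loewner`; Krachun–Panagiotis's dichotomy (4)/(5) with Lemmas 3.2–3.3 in
confined form): for `T ≥ 1` and caps `M₁ ≥ M_k` on `[T, 2T)`, `M₂ ≥ M_i` on `[4T, 5T)`, either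
`(cos(π/8)/(16cos(π/4)))·T·triDl(2T)·triDl(5T) ≤ (1 + M₁)·W(T)` or
`(15/64)·T²·triDl(2T)·triDl(5T)·triDl(9T) ≤ (1 + M₁)(1 + M₂)·W(T)`, where `W(T)` is the coded floor-arch
mass of the strip `S_{32T+1,32T+1}` over the window of offsets `[T, 21T]`.
[cite: KrachunPanagiotis2026, Lemmas 3.2–3.3 and eqs. (4)–(5)] -/
theorem stub_kp_dichotomy : ∀ (T : ℕ), 1 ≤ T → ∀ (M₁ M₂ : ℝ), (∀ k : ℕ, T ≤ k → k < 2 * T → renCap k ≤ M₁) → (∀ i : ℕ, 4 * T ≤ i → i < 5 * T → renCap i ≤ M₂) → Real.cos (Real.pi / 8) / (16 * Real.cos (Real.pi / 4)) * (T : ℝ) * Literature.Probability.RandomPlanarGeometry.SAW.HV.triDl (2 * T) * Literature.Probability.RandomPlanarGeometry.SAW.HV.triDl (5 * T) ≤ (1 + M₁) * ∑ d ∈ Finset.Icc (T : ℤ) (21 * T), ∑ P ∈ (Literature.Probability.RandomPlanarGeometry.SAW.HV.midWalks (Literature.Probability.RandomPlanarGeometry.SAW.HV.stripV (32 * T + 1)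 (32 * T + 1))).filter (fun P => Literature.Probability.RandomPlanarGeometry.SAW.HV.finalDart P = ((d, 0, false), (d, -1, true)) ∨ Literature.Probability.RandomPlanarGeometry.SAW.HV.finalDart P = ((d, -1, true), (d, 0, false))), Literature.Probability.RandomPlanarGeometry.SAW.hexCriticalFugacity ^ Literature.Probability.RandomPlanarGeometry.SAW.HV.mwLen P ∨ (15 / 64 : ℝ) * (T : ℝ) ^ 2 * Literature.Probability.RandomPlanarGeometry.SAW.HV.triDl (2 * T) * Literature.Probability.RandomPlanarGeometry.SAW.HV.triDl (5 * T) * Literature.Probability.RandomPlanarGeometry.SAW.HV.triDl (9 * T) ≤ (1 + M₁) * (1 + M₂) * ∑ d ∈ Finset.Icc (T : ℤ) (21 * T), ∑ P ∈ (Literature.Probability.RandomPlanarGeometry.SAW.HV.midWalks (Literature.Probability.RandomPlanarGeometry.SAW.HV.stripV (32 * T + 1) (32 * T + 1))).filter (fun P => Literature.Probability.RandomPlanarGeometry.SAW.HV.finalDart P = ((d, 0, false), (d, -1, true)) ∨ Literature.Probability.RandomPlanarGeometry.SAW.HV.finalDart P = ((d, -1, true), (d, 0, false))), Literature.Probability.RandomPlanarGeometry.SAW.hexCriticalFugacity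 ^ Literature.Probability.RandomPlanarGeometry.SAW.HV.mwLen P := by
  intro T hT M₁ M₂ hM₁ hM₂
  have hsum : 7 / 8 * (T : ℝ) * triDl (2 * T) ≤
      (∑ k ∈ Ico T (2 * T), ∑ P ∈ (rightWalks k).filter
          (fun P => (renewals k P : ℝ) ≤ renCap k ∧ GoodHt T (htOf P)), hexCriticalFugacity ^ mwLen P) +
      ∑ k ∈ Ico T (2 * T), ∑ P ∈ (rightWalks k).filter
          (fun P => (renewals k P : ℝ) ≤ renCap k ∧ ¬ GoodHt T (htOf P)), hexCriticalFugacity ^ mwLen P := by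
    have h := dich_kept_sum_ge T
    rw [sum_congr rfl (fun k _ => dich_split T k), sum_add_distrib] at h
    exact h
  have hM₁0 : 0 ≤ 1 + M₁ := by linarith [kpCount_renCap_nonneg T, hM₁ T le_rfl (by omega)]
  have ht2 := triDl_nonneg (2 * T)
  have ht5 := triDl_nonneg (5 * T)
  have ht9 := triDl_nonneg (9 * T)
  have hc4 := cos_pi_div_four_pos'
  have hc8 := cos_pi_div_eight_pos
  have hW0 : 0 ≤ ∑ d ∈ Icc (T : ℤ) (21 * T), ∑ P ∈ (midWalks (stripV (32 * T + 1) (32 * T + 1))).filter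
      (fun P => finalDart P = ((d, 0, false), (d, -1, true)) ∨ finalDart P = ((d, -1, true), (d, 0, false))),
        hexCriticalFugacity ^ mwLen P :=
    sum_nonneg fun _ _ => sum_nonneg fun _ _ => pow_nonneg dich_xc_nonneg _
  by_cases hA : 1 / 4 * (T : ℝ) * triDl (2 * T) ≤
      ∑ k ∈ Ico T (2 * T), ∑ P ∈ (rightWalks k).filter
          (fun P => (renewals k P : ℝ) ≤ renCap k ∧ GoodHt T (htOf P)), hexCriticalFugacity ^ mwLen P
  · left
    have hcA := stub_kp_countA T hT M₁ hM₁
    have hwin : ∑ d ∈ Icc ((T : ℤ) + 1) (7 * T), ∑ P ∈ (midWalks (stripV (32 * T + 1) (32 * T + 1))).filter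
        (fun P => finalDart P = ((d, 0, false), (d, -1, true)) ∨ finalDart P = ((d, -1, true), (d, 0, false))),
          hexCriticalFugacity ^ mwLen P ≤
        ∑ d ∈ Icc (T : ℤ) (21 * T), ∑ P ∈ (midWalks (stripV (32 * T + 1) (32 * T + 1))).filter
        (fun P => finalDart P = ((d, 0, false), (d, -1, true)) ∨ finalDart P = ((d, -1, true), (d, 0, false))),
          hexCriticalFugacity ^ mwLen P :=
      sum_le_sum_of_subset_of_nonneg (Icc_subset_Icc (by omega) (by omega))
        fun _ _ _ => sum_nonneg fun _ _ => pow_nonneg dich_xc_nonneg _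
    have h1 := dich_caseA_ge T
    have he : 1 / 4 * (T : ℝ) * triDl (2 * T) * (Real.cos (Real.pi / 8) / (2 * Real.cos (Real.pi / 4)) * triDl (5 * T)) =
        2 * (Real.cos (Real.pi / 8) / (16 * Real.cos (Real.pi / 4)) * (T : ℝ) * triDl (2 * T) * triDl (5 * T)) := by
      ring
    have hca : 0 < Real.cos (Real.pi / 8) / (16 * Real.cos (Real.pi / 4)) := div_pos hc8 (mul_pos (by norm_num) hc4)
    have hx : 0 ≤ Real.cos (Real.pi / 8) / (16 * Real.cos (Real.pi / 4)) * (T : ℝ) * triDl (2 * T) * triDl (5 * T) :=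
      mul_nonneg (mul_nonneg (mul_nonneg hca.le (Nat.cast_nonneg T)) ht2) ht5
    have h2 := mul_le_mul_of_nonneg_right hA
      (mul_nonneg (div_pos hc8 (mul_pos two_pos hc4)).le ht5)
    have h3 := mul_le_mul_of_nonneg_left hwin hM₁0
    linarith
  · right
    have hB : 5 / 8 * (T : ℝ) * triDl (2 * T) ≤
        ∑ k ∈ Ico T (2 * T), ∑ P ∈ (rightWalks k).filter
          (fun P => (renewals k P : ℝ) ≤ renCap k ∧ ¬ GoodHt T (htOf P)), hexCriticalFugacity ^ mwLen P := by
      push Not at hA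
      linarith
    have hcB := stub_kp_countB T hT M₁ M₂ hM₁ hM₂
    have h1 := dich_caseB_ge T
    have he : (15 / 64 : ℝ) * (T : ℝ) ^ 2 * triDl (2 * T) * triDl (5 * T) * triDl (9 * T) =
        5 / 8 * (T : ℝ) * triDl (2 * T) * ((T : ℝ) * (3 / 8 * triDl (5 * T) * triDl (9 * T))) := by ring
    have h2 := mul_le_mul_of_nonneg_right hB
      (mul_nonneg (Nat.cast_nonneg T) (mul_nonneg (mul_nonneg (show (0 : ℝ) ≤ 3 / 8 by norm_num) ht5) ht9))
    linarith

end Summit.CriticalPhenomena.SAWScalingLimit.Theorems.HexConjecture.RootLocality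

end
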